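import Summits.BirchSwinnertonDyer.BirchSwinnertonDyer.Theorems.ManinLocalTwoThreeDegeneracyUnitTwist
import Summits.BirchSwinnertonDyer.Rank1Residual.ManinAdditive.KatoCurvePlusDefectLevers
import HarnessLib

/-!
# THEOREM U (es g22, MEMO-es §36.11), part 3/3: the `3`-adic POLAR witness at SQUAREFULL level from the ratio-`9` degeneracy
# plus index — E-es-90; E-es-66 on the squarefull locus ⟸ E-es-68₉; `3 ∤ c(W)` there modulo Kato's fact (+ E-es-68₉)

Summit `BirchSwinnertonDyer`, route `ManinLocalTwoThree` (cell bsd-f2-manin), crux C3 `ManinPrimeToThreeAtNine`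
(stmt-BirchSwinnertonDyer-22968).

* `threeAdicPolarWitness_of_degeneracyNinePlusIndex` — a datum `D` of `W` ADDITIVE at `3` (hypothesis `hadd`; in the line it is
  the crux binder's `additive_at_three_of_nine_dvd_level hnf D h9`) at a SQUAREFULL level `9 ∣ N` whose newform has ratio-`9`
  degeneracy plus index prime to `3` carries a `ThreeAdicPolarWitness W W D.f` (ρ = 1; the `N`-imprimitive Euler product over
  `ℓ ∥ N` is EMPTY) — es's **E-es-90**, now a theorem.
* `threeAdicPolarWitness_of_degeneracyLoopLawNine` — **E-es-66 on the squarefull locus ⟸ E-es-68₉** (`DegeneracyLoopLawNine`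
  makes `closure (degeneracyLoops f 9) = Λ₁(f)`, so `PlusIndexPrimeTo 3 D.f` IS the ratio-`9` degeneracy plus index): the es lens's
  charter candidate at `3` reduced, on squarefull levels, to ONE E-blind lattice law of `X₀(N)` (Ribet–Ihara equaliser at `p ∣ N`).
* `not_three_dvd_maninConstant_of_degeneracyLoopLawNine_squarefull` (+ `…_irreducible` from F-es-18 via `katoFactThreeAt_of_polar`,
  + the law-free `…_of_degeneracyNinePlusIndex_squarefull`) — **`3 ∤ D.c`** for every lattice-optimal datum of a globally minimal
  `W` additive at `3` at a COMPOSITE squarefull level `9 ∣ N` (a prime `q ≠ 3` with `q² ∣ N` discharges the plus index by the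
  tree's Hecke sieve `plusIndexPrimeTo_three_of_sq_dvd`), modulo `KatoFactThreeAt W D.f` and E-es-68₉ — EVERY Kosters–Pannekoek
  class `ā`, no `χ(3)`-hole (the t = 9 character has `χ(9) ≠ 1`).

HONEST FRAMING: CONDITIONAL reductions (E-es-68₉ is a typed `@[conjecture]` lattice law; F-es-18 / `KatoFactThreeAt` is Kato's
printed theorem as a Literature `def`); unconditional content = parts 1–2.  C3, Manin's conjecture and BSD are NOT proved by
this.  No definitions, no named facts, no sorry.
-/

set_option linter.dupNamespace false
set_option autoImplicit false

noncomputable section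

open scoped Classical MatrixGroups ModularForm ComplexConjugate

open CongruenceSubgroup Complex Literature.NumberTheory.EllipticCurves
  Literature.NumberTheory.EllipticCurves.ModularForms
  Summit.BirchSwinnertonDyer.Rank1Residual.ManinAdditive.Gamma1Lattice
  Summit.BirchSwinnertonDyer.Rank1Residual.ManinAdditive.KatoCurve

namespace Summit.BirchSwinnertonDyer.BirchSwinnertonDyer.Theorems.ManinLocalTwoThree

/-! ### §5 W-level at SQUAREFULL level: the polar witness, E-es-66 ⟸ E-es-68₉, and `3 ∤ c` -/

/-- **E-es-90 (THEOREM U (b)), W-level**: a datum `D` of `W`, `W` ADDITIVE at `3` (`hadd`; from the crux binder via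
`additive_at_three_of_nine_dvd_level hnf D h9`), at a SQUAREFULL level `9 ∣ N` whose newform has ratio-`9` degeneracy plus
index prime to `3` carries a `3`-adic even POLAR unit witness against `Ω(W)` (ρ = 1; the `N`-imprimitive Euler product over
`ℓ ∥ N` is empty). -/
theorem threeAdicPolarWitness_of_degeneracyNinePlusIndex
    (W : WeierstrassCurve ℚ) [W.IsElliptic] {N : ℕ} [NeZero N] (D : ModularParametrizationData W N)
    (hadd : ¬ W.HasGoodReductionAtPrime 3 ∧ ¬ W.HasMultiplicativeReductionAtPrime 3)
    (h9 : 3 ^ 2 ∣ N) (hsq : ∀ ℓ ∈ N.primeFactors, ℓ ^ 2 ∣ N)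
    (hd : ∀ x ∈ periodLattice D.f, ∃ y ∈ AddSubgroup.closure (degeneracyLoops D.f 9), ∃ k : ℕ, ¬ 3 ∣ k ∧
      (k : ℂ) * (x + conj x) = y + conj y) :
    ThreeAdicPolarWitness W W D.f := by
  have h3 : 3 ∣ N := dvd_trans (by norm_num) h9
  obtain ⟨m, hm, χ, r, hcop, hprim, hχ1, hord, h3a, h3b, hev, hr, hu⟩ :=
    tamePolarUnitTwistOfDegeneracyNinePlusIndex D.isNewformOf.1 D.isNewformOf.coeffField_eq_bot h3 hd
  have hempty : (N.primeFactors.filter fun ℓ ↦ ¬ ℓ ^ 2 ∣ N) = ∅ :=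
    Finset.filter_eq_empty_iff.mpr fun ℓ hℓ h ↦ h (hsq ℓ hℓ)
  refine ⟨m, hm, χ, r, 1, D.isNewformOf, hadd.1, hadd.2, hcop, hprim, hχ1, hord, h3a, h3b, hev, by simp, ?_, ?_⟩
  · rw [hempty, Finset.prod_empty, one_mul, hr]
  · intro s hs
    have : (s : ℂ) * r * ((1 : ℚ) : ℂ) / 3 = (s : ℂ) * r / 3 := by push_cast; ring
    rw [this]
    exact hu s hs

/-- **E-es-66 on the squarefull locus ⟸ E-es-68₉** (for `W` additive at `3`): the ratio-`9` degeneracy-loop law makes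
`closure (degeneracyLoops f 9) = Λ₁(f)`, so `PlusIndexPrimeTo 3 D.f` is the ratio-`9` degeneracy plus index. -/
theorem threeAdicPolarWitness_of_degeneracyLoopLawNine (h68 : DegeneracyLoopLawNine)
    (W : WeierstrassCurve ℚ) [W.IsElliptic] {N : ℕ} [NeZero N] (D : ModularParametrizationData W N)
    (hadd : ¬ W.HasGoodReductionAtPrime 3 ∧ ¬ W.HasMultiplicativeReductionAtPrime 3)
    (h9 : 3 ^ 2 ∣ N) (hsq : ∀ ℓ ∈ N.primeFactors, ℓ ^ 2 ∣ N) (hpi : PlusIndexPrimeTo 3 D.f) :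
    ThreeAdicPolarWitness W W D.f := by
  refine threeAdicPolarWitness_of_degeneracyNinePlusIndex W D hadd h9 hsq fun x hx ↦ ?_
  obtain ⟨y, hy, k, hk, hxy⟩ := hpi x hx
  exact ⟨y, by rw [h68 h9 D.f]; exact hy, k, hk, hxy⟩

/-- **`3 ∤ c(W)` at COMPOSITE SQUAREFULL level modulo `KatoFactThreeAt W D.f` and E-es-68₉** (every Kosters–Pannekoek
class): for a lattice-optimal datum `D` of a globally minimal `W` at a squarefull level `9 ∣ N` with a second prime
`q ≠ 3`, `q² ∣ N` (this discharges the plus index: `plusIndexPrimeTo_three_of_sq_dvd`), Kato's fact at `W` and the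
ratio-`9` degeneracy-loop law give `3 ∤ D.c`. CONDITIONAL. -/
theorem not_three_dvd_maninConstant_of_degeneracyLoopLawNine_squarefull (h68 : DegeneracyLoopLawNine)
    (W : WeierstrassCurve ℚ) [W.IsElliptic] [W.IsGloballyMinimal] {N : ℕ} [NeZero N]
    (D : ModularParametrizationData W N) (hF : KatoFactThreeAt W D.f)
    (hadd : ¬ W.HasGoodReductionAtPrime 3 ∧ ¬ W.HasMultiplicativeReductionAtPrime 3)
    (hopt : ∀ z ∈ D.L.lattice, ∃ w ∈ periodLattice D.f, z = D.c * w)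
    (h9 : 3 ^ 2 ∣ N) (hsq : ∀ ℓ ∈ N.primeFactors, ℓ ^ 2 ∣ N)
    {q : ℕ} (hq : q.Prime) (hq3 : q ≠ 3) (hqN : q ^ 2 ∣ N) : ¬ (3 : ℤ) ∣ D.c := by
  have hwit : ThreeAdicPolarWitness W W D.f :=
    threeAdicPolarWitness_of_degeneracyLoopLawNine h68 W D hadd h9 hsq (plusIndexPrimeTo_three_of_sq_dvd D hq hq3 hqN)
  have hΩ : W.realPeriodRat = ((|D.c| : ℤ) : ℝ) * plusPeriod D.f := by
    rw [Int.cast_abs]; exact D.realPeriodRat_eq_abs_mul_plusPeriod_of_latticeEq hopt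
  have hc0 : D.c ≠ 0 := D.maninConstant_ne_zero_holds
  have h := not_three_dvd_of_katoFactThreeAt_of_witness W W D.f |D.c| hF hwit hΩ (abs_ne_zero.mpr hc0)
  exact fun h3 ↦ h ((dvd_abs 3 D.c).mpr h3)

/-- **The same from F-es-18 on the `E[3]`-IRREDUCIBLE locus** (`katoFactThreeAt_of_polar`): modulo Kato's printed fact
(stub 1 of line `kato_shift_three`) and E-es-68₉, `3 ∤ c(W)` for every lattice-optimal `W` with `W[3]` irreducible at a
composite squarefull level `9 ∣ N`. CONDITIONAL. [cite: Kato2004Asterisque, Thm. 9.7 (p. 189)] -/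
theorem not_three_dvd_maninConstant_of_degeneracyLoopLawNine_squarefull_irreducible (h68 : DegeneracyLoopLawNine)
    (hK : kato_neron_isIntegral_twistedSymbolSum_of_additive_three_polar)
    (W : WeierstrassCurve ℚ) [W.IsElliptic] [W.IsGloballyMinimal] {N : ℕ} [NeZero N]
    (D : ModularParametrizationData W N) (hirr : W.HasIrreducibleModPGaloisRep 3)
    (hadd : ¬ W.HasGoodReductionAtPrime 3 ∧ ¬ W.HasMultiplicativeReductionAtPrime 3)
    (hopt : ∀ z ∈ D.L.lattice, ∃ w ∈ periodLattice D.f, z = D.c * w)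
    (h9 : 3 ^ 2 ∣ N) (hsq : ∀ ℓ ∈ N.primeFactors, ℓ ^ 2 ∣ N)
    {q : ℕ} (hq : q.Prime) (hq3 : q ≠ 3) (hqN : q ^ 2 ∣ N) : ¬ (3 : ℤ) ∣ D.c :=
  not_three_dvd_maninConstant_of_degeneracyLoopLawNine_squarefull h68 W D
    (katoFactThreeAt_of_polar hK W D.f hirr) hadd hopt h9 hsq hq hq3 hqN

/-- **Law-free form**: with the f-SPECIFIC ratio-`9` degeneracy plus index of `D.f` in place of the lattice law E-es-68₉
(decidable per class; certified at every `9 ∣ M ≤ 243`, es E42g), `3 ∤ c(W)` at squarefull level `9 ∣ N` modulo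
`KatoFactThreeAt W D.f` alone. CONDITIONAL on Kato's fact. -/
theorem not_three_dvd_maninConstant_of_degeneracyNinePlusIndex_squarefull
    (W : WeierstrassCurve ℚ) [W.IsElliptic] [W.IsGloballyMinimal] {N : ℕ} [NeZero N]
    (D : ModularParametrizationData W N) (hF : KatoFactThreeAt W D.f)
    (hadd : ¬ W.HasGoodReductionAtPrime 3 ∧ ¬ W.HasMultiplicativeReductionAtPrime 3)
    (hopt : ∀ z ∈ D.L.lattice, ∃ w ∈ periodLattice D.f, z = D.c * w)
    (h9 : 3 ^ 2 ∣ N) (hsq : ∀ ℓ ∈ N.primeFactors, ℓ ^ 2 ∣ N)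
    (hd : ∀ x ∈ periodLattice D.f, ∃ y ∈ AddSubgroup.closure (degeneracyLoops D.f 9), ∃ k : ℕ, ¬ 3 ∣ k ∧
      (k : ℂ) * (x + conj x) = y + conj y) : ¬ (3 : ℤ) ∣ D.c := by
  have hwit : ThreeAdicPolarWitness W W D.f := threeAdicPolarWitness_of_degeneracyNinePlusIndex W D hadd h9 hsq hd
  have hΩ : W.realPeriodRat = ((|D.c| : ℤ) : ℝ) * plusPeriod D.f := by
    rw [Int.cast_abs]; exact D.realPeriodRat_eq_abs_mul_plusPeriod_of_latticeEq hopt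
  have hc0 : D.c ≠ 0 := D.maninConstant_ne_zero_holds
  have h := not_three_dvd_of_katoFactThreeAt_of_witness W W D.f |D.c| hF hwit hΩ (abs_ne_zero.mpr hc0)
  exact fun h3 ↦ h ((dvd_abs 3 D.c).mpr h3)

end Summit.BirchSwinnertonDyer.BirchSwinnertonDyer.Theorems.ManinLocalTwoThree

end
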